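import Mathlib
import HarnessLib
import Literature.Probability.MarkovChains.LogSobolevConstant
import Literature.Probability.MarkovChains.DistinguishingStatistic
import Literature.Probability.ImportanceSampling.OptimalImportanceDistribution
import Literature.InformationTheory.Entropy.GibbsInequality

/-!
# The Gibbs variational principle and the Donsker–Varadhan formula for finite laws, with their maximisers

[cite: PolyanskiyWu2024, Thm 4.6 (eq. (4.11)); Prop 4.7; eq. (4.13)]

The measure-theoretic statements for Mathlib's `InformationTheory.klDiv` are ALREADY in the tree:
`Probability/Divergences/FDivVariational.lean` (easy half `∫ g dμ − log ∫ e^g dν ≤ KL(μ‖ν)`),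
`Probability/Divergences/DonskerVaradhan.lean` (hard half, bounded measurable test functions) and
`Probability/Divergences/KLDivConvexity.lean` (log form).  THIS file is the elementary finite-law form in
the vocabulary of the finite Markov-chain / entropy files (`relEnt`, `lawMean`, `tilt` — no measures, no
Radon–Nikodym derivatives), and what it adds is the EXPLICIT MAXIMISERS: the supremum in (4.11) is
attained at `f = log(P/Q)` and the one in Prop 4.7 at the tilted law `Q^f`, both as `IsGreatest`
statements, plus the tilting identity `D(P‖Q) − (E_P f − ψ_f) = D(P‖Q^f)` behind them.

For laws on a finite set written as functions (`P ≥ 0`, `Q > 0`, total mass one), with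
`D = relEnt` (`Σ_x P(x) log(P(x)/Q(x))`, `MarkovChains/LogSobolevConstant.lean`), `E_P f = lawMean P f`
(`DistinguishingStatistic.lean`) and the TILTED LAW `Q^f = e^f Q / E_Q e^f` — the tree's
`tilt Q (exp ∘ f)` of `ImportanceSampling/OptimalImportanceDistribution.lean` ("`Q^f(dx) =
exp{f(x) − ψ_f} Q(dx)`, `ψ_f ≜ log E_Q[exp{f(X)}]`" [cite: PolyanskiyWu2024, eq. (4.13)]) — this file
PROVES (0 named facts, no new definition):

* **Donsker–Varadhan** [cite: PolyanskiyWu2024, Thm 4.6 (eq. (4.11))] ("`D(P‖Q) = sup_f E_P[f(X)] −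
  log E_Q[exp{f(X)}]`"): `lawMean_sub_log_sum_exp_le_relEnt` (every `f` gives a lower bound — the
  identity `D(P‖Q) − (E_P f − ψ_f) = D(P‖Q^f) ≥ 0`, `relEnt_sub_eq_relEnt_tilt`), and for `P > 0` the
  supremum is attained at `f = log(P/Q)`: `PolyanskiyWu2024_thm_4_6` (`IsGreatest`);
* **Gibbs variational principle** [cite: PolyanskiyWu2024, Prop 4.7] ("`log E_Q[exp{f(X)}] =
  sup_P E_P[f(X)] − D(P‖Q)` … the unique maximizer … is `P = Q^f`"): `lawMean_sub_relEnt_le_log_sum_exp`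
  and `PolyanskiyWu2024_prop_4_7` (`IsGreatest`, attained at `tilt Q (exp ∘ f)`);
* the **entropy (transfer) inequality** `lawMean_le_relEnt_add_log_sum_exp_div`:
  `E_P f ≤ (D(P‖Q) + log E_Q e^{λf})/λ` for `λ > 0` — the form in which the relative entropy method
  uses it (cf. the measure-theoretic `Entropy/EntropyInequality.lean`, `DonskerVaradhanTransfer.lean`).

Context (cell pub-lqcd, venture LatticeQCDFlow): reweighting a sampler's output `Q` to a target by
`e^f` (free-energy / Jarzynski-type estimators) is controlled exactly by these two dual formulas:
`log E_Q e^f ≥ E_P f − D(P‖Q)` for every `P`, with equality at the reweighted law.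
-/

namespace Literature.Probability.Entropy

open Finset Real
open Literature.Probability.MarkovChains Literature.Probability.ImportanceSampling

variable {X : Type*} [Fintype X]

/-- The normalising constant `Z = E_Q e^f = Σ_x e^{f(x)} Q(x) > 0` for `Q > 0`.
[cite: PolyanskiyWu2024, eq. (4.13) (`ψ_f = log E_Q[exp f]`)] -/
theorem sum_exp_mul_pos [Nonempty X] {Q : X → ℝ} (hQ : ∀ x, 0 < Q x) (f : X → ℝ) :
    0 < ∑ x, Real.exp (f x) * Q x :=
  sum_pos (fun x _ => mul_pos (Real.exp_pos _) (hQ x)) univ_nonempty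

/-- **The tilting identity**: `D(P ‖ Q) − (E_P f − log E_Q e^f) = D(P ‖ Q^f)` for a law `P ≥ 0` of
mass one and `Q > 0`. [cite: PolyanskiyWu2024, Thm 4.6 (proof of (4.11), "`D ≥ sup`": the tilted
measure (4.13) and (2.11))] -/
theorem relEnt_sub_eq_relEnt_tilt [Nonempty X] {P Q : X → ℝ} (hP1 : ∑ x, P x = 1)
    (hQ : ∀ x, 0 < Q x) (f : X → ℝ) :
    relEnt P Q - (lawMean P f - Real.log (∑ x, Real.exp (f x) * Q x))
      = relEnt P (tilt Q (fun x => Real.exp (f x))) := by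
  have hZ := sum_exp_mul_pos hQ f
  unfold relEnt lawMean
  -- termwise: `P log(P/Q^f) = P log(P/Q) − P f + P log Z` (both sides vanish when `P(x) = 0`)
  have hpt : ∀ x, P x * Real.log (P x / tilt Q (fun x => Real.exp (f x)) x)
      = P x * Real.log (P x / Q x) - P x * f x + P x * Real.log (∑ y, Real.exp (f y) * Q y) := by
    intro x
    by_cases hPx : P x = 0
    · simp [hPx]
    · have hQx := (hQ x).ne'
      rw [tilt_def]
      rw [show P x / (Real.exp (f x) * Q x / ∑ y, Real.exp (f y) * Q y)
          = P x / Q x / Real.exp (f x) * ∑ y, Real.exp (f y) * Q y by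
            field_simp]
      rw [Real.log_mul (by positivity) hZ.ne', Real.log_div (div_ne_zero hPx hQx) (Real.exp_ne_zero _),
        Real.log_exp]
      ring
  simp_rw [hpt, sum_add_distrib, sum_sub_distrib, ← sum_mul, hP1, one_mul]
  ring

/-- **Donsker–Varadhan, lower bound** [cite: PolyanskiyWu2024, Thm 4.6 (eq. (4.11))]: for every
`f : X → ℝ`, `E_P f − log E_Q e^f ≤ D(P ‖ Q)` (`P ≥ 0` of mass one, `Q > 0` of mass one). -/
theorem lawMean_sub_log_sum_exp_le_relEnt [Nonempty X] {P Q : X → ℝ} (hP0 : ∀ x, 0 ≤ P x)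
    (hP1 : ∑ x, P x = 1) (hQ : ∀ x, 0 < Q x) (f : X → ℝ) :
    lawMean P f - Real.log (∑ x, Real.exp (f x) * Q x) ≤ relEnt P Q := by
  have h := relEnt_sub_eq_relEnt_tilt hP1 hQ f
  have hZ := sum_exp_mul_pos hQ f
  have hpos : ∀ x, 0 < tilt Q (fun x => Real.exp (f x)) x := fun x => by
    rw [tilt_def]; exact div_pos (mul_pos (Real.exp_pos _) (hQ x)) hZ
  have hG : 0 ≤ relEnt P (tilt Q (fun x => Real.exp (f x))) :=
    Literature.InformationTheory.Entropy.sum_mul_log_div_nonneg hP0 hpos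
      (by rw [hP1, sum_tilt hZ.ne'])
  linarith

/-- **Donsker–Varadhan** [cite: PolyanskiyWu2024, Thm 4.6 (eq. (4.11))] ("`D(P‖Q) = sup_f E_P[f(X)] −
log E_Q[exp{f(X)}]`"): for strictly positive laws the supremum is attained at `f = log(P/Q)`, so
`D(P ‖ Q)` is the greatest element of `{E_P f − log E_Q e^f : f}`. -/
theorem PolyanskiyWu2024_thm_4_6 [Nonempty X] {P Q : X → ℝ} (hP : ∀ x, 0 < P x) (hP1 : ∑ x, P x = 1)
    (hQ : ∀ x, 0 < Q x) :
    IsGreatest {d : ℝ | ∃ f : X → ℝ, d = lawMean P f - Real.log (∑ x, Real.exp (f x) * Q x)}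
      (relEnt P Q) := by
  refine ⟨⟨fun x => Real.log (P x / Q x), ?_⟩, ?_⟩
  · -- `E_P log(P/Q) − log Σ_x Q (P/Q) = D − log 1`
    have e : ∀ x, Real.exp (Real.log (P x / Q x)) * Q x = P x := fun x => by
      rw [Real.exp_log (div_pos (hP x) (hQ x)), div_mul_cancel₀ _ (hQ x).ne']
    simp_rw [e, hP1, Real.log_one, sub_zero]
    rfl
  · rintro d ⟨f, rfl⟩
    exact lawMean_sub_log_sum_exp_le_relEnt (fun x => (hP x).le) hP1 hQ f

/-- **Gibbs variational principle, upper bound** [cite: PolyanskiyWu2024, Prop 4.7]: for every law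
`P ≥ 0` of mass one, `E_P f − D(P ‖ Q) ≤ log E_Q e^f`. -/
theorem lawMean_sub_relEnt_le_log_sum_exp [Nonempty X] {P Q : X → ℝ} (hP0 : ∀ x, 0 ≤ P x)
    (hP1 : ∑ x, P x = 1) (hQ : ∀ x, 0 < Q x) (f : X → ℝ) :
    lawMean P f - relEnt P Q ≤ Real.log (∑ x, Real.exp (f x) * Q x) := by
  linarith [lawMean_sub_log_sum_exp_le_relEnt hP0 hP1 hQ f]

/-- The tilted law attains it: `E_{Q^f} f − D(Q^f ‖ Q) = log E_Q e^f`. [cite: PolyanskiyWu2024, Prop 4.7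
("the unique maximizer … is `P = Q^f`")] -/
theorem lawMean_tilt_sub_relEnt_tilt [Nonempty X] {Q : X → ℝ} (hQ : ∀ x, 0 < Q x) (f : X → ℝ) :
    lawMean (tilt Q (fun x => Real.exp (f x))) f - relEnt (tilt Q (fun x => Real.exp (f x))) Q
      = Real.log (∑ x, Real.exp (f x) * Q x) := by
  have hZ := sum_exp_mul_pos hQ f
  set T := tilt Q (fun x => Real.exp (f x)) with hT
  have hT1 : ∑ x, T x = 1 := sum_tilt hZ.ne'
  have h := relEnt_sub_eq_relEnt_tilt (P := T) hT1 hQ f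
  -- `D(T ‖ T) = 0`
  have h0 : relEnt T T = 0 := by
    unfold relEnt
    refine sum_eq_zero fun x _ => ?_
    by_cases hx : T x = 0
    · rw [hx, zero_mul]
    · rw [div_self hx, Real.log_one, mul_zero]
  rw [← hT, h0] at h
  linarith

/-- **Gibbs variational principle** [cite: PolyanskiyWu2024, Prop 4.7] ("`log E_Q[exp{f(X)}] =
sup_P E_P[f(X)] − D(P‖Q)`", maximiser `Q^f` of (4.13)): `log E_Q e^f` is the greatest element of
`{E_P f − D(P‖Q) : P ≥ 0 a law}`, attained at `P = tilt Q (exp ∘ f)`. -/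
theorem PolyanskiyWu2024_prop_4_7 [Nonempty X] {Q : X → ℝ} (hQ : ∀ x, 0 < Q x) (f : X → ℝ) :
    IsGreatest {d : ℝ | ∃ P : X → ℝ, (∀ x, 0 ≤ P x) ∧ ∑ x, P x = 1 ∧ d = lawMean P f - relEnt P Q}
      (Real.log (∑ x, Real.exp (f x) * Q x)) := by
  have hZ := sum_exp_mul_pos hQ f
  refine ⟨⟨tilt Q (fun x => Real.exp (f x)), tilt_nonneg (fun x => (hQ x).le) (fun x => (Real.exp_pos _).le),
    sum_tilt hZ.ne', (lawMean_tilt_sub_relEnt_tilt hQ f).symm⟩, ?_⟩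
  rintro d ⟨P, hP0, hP1, rfl⟩
  exact lawMean_sub_relEnt_le_log_sum_exp hP0 hP1 hQ f

/-- **The entropy inequality** (transfer of expectations through relative entropy): for `λ > 0`,
`E_P f ≤ (D(P ‖ Q) + log E_Q e^{λ f}) / λ`. [cite: PolyanskiyWu2024, Thm 4.6 (eq. (4.11) with
`f ← λf`)] -/
theorem lawMean_le_relEnt_add_log_sum_exp_div [Nonempty X] {P Q : X → ℝ} (hP0 : ∀ x, 0 ≤ P x)
    (hP1 : ∑ x, P x = 1) (hQ : ∀ x, 0 < Q x) (f : X → ℝ) {l : ℝ} (hl : 0 < l) :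
    lawMean P f ≤ (relEnt P Q + Real.log (∑ x, Real.exp (l * f x) * Q x)) / l := by
  have h := lawMean_sub_log_sum_exp_le_relEnt hP0 hP1 hQ (fun x => l * f x)
  have hmean : lawMean P (fun x => l * f x) = l * lawMean P f := by
    unfold lawMean
    rw [mul_sum]
    exact sum_congr rfl fun x _ => by ring
  rw [hmean] at h
  rw [le_div_iff₀ hl]
  linarith

end Literature.Probability.Entropy
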